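import Summits.Ventures.HodgeRepro2.T5CMRealBaseChange
import Mathlib.LinearAlgebra.TensorProduct.Pi
import Mathlib.LinearAlgebra.Matrix.Hermitian
import Mathlib.LinearAlgebra.Matrix.Charpoly.Basic
import Mathlib.Analysis.Matrix.PosDef

/-!
# Tier-5 support (seat p3, cell pub-hodge-repro2) — a hermitian space over a CM field at a
real place of `K⁺`: `V ⊗_{K⁺,τ} ℝ = ℂⁿ` with the complex Gram form, the signature convention,
and `D_τ > 0`

Behind route/T4-B1-p3.md v7 (sub-claim B1, FINAL): l. 33 «V ⊗_{A_{F⁺},τ} ℝ = ℂ³ with the form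
x₁ȳ₁ + x₂ȳ₂ + x₃ȳ₃ = the standard positive definite form», l. 41 «the signature of V ⊗_{F,τ} ℝ
(Liu p. 107 l. 23) is that of a hermitian form over E ⊗_{F,τ} ℝ ≅ ℂ; the identification with ℂ
depends on the choice of τ′ ∈ π⁻¹(τ), but the two choices differ by complex conjugation of the
Gram matrix, which has the same eigenvalues», and l. 35 «at a real place τ, D_τ > 0 (the Gram
matrix of a positive definite hermitian form on ℂ³ has positive determinant)» — on Mathlib's
`NumberField.IsCMField K` (`star = complexConj K`), with the real place and its extensions
`φ : K →ₐ[K⁺] ℂ` as in `T5CMRealBaseChange` (file 102).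

* `semiconj_star`: every complex embedding intertwines `star = complexConj K` with `conj`;
  `isHermitian_map`: the complex Gram matrix `H.map φ` of a hermitian `H` is hermitian.
* `piBaseChangeEquiv K φ : ℝ ⊗[K⁺] (ι → K) ≃ₗ[ℝ] (ι → ℂ)` (Mathlib's `TensorProduct.piRight`
  composed with file 102's `baseChangeEquiv`), `r ⊗ v ↦ (r • φ (v i))_i`, and
  `gram_piBaseChangeEquiv_tmul`: the complex Gram form `star x ⬝ᵥ (H.map φ) *ᵥ y` of the
  base-changed vectors is `(r s) • φ` of the Gram form `star v ⬝ᵥ H *ᵥ w` over `K` — B1 l. 33's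
  «V ⊗_{F⁺,τ} ℝ = ℂ³ with the form».
* `map_conjExt_eq_transpose` / `charpoly_map_conjExt` / `det_map_conjExt`: through the other
  extension `conj ∘ φ` the Gram matrix is the entrywise conjugate = the TRANSPOSE (hermitian),
  with the same characteristic polynomial (hence the same eigenvalues, hence the same signature)
  and the same determinant — B1 l. 41 / Liu p. 107 l. 23; `det_map_real`: that determinant is
  real.
* `det_pos_of_posDef` / `det_re_pos_of_posDef`: a positive definite complex Gram matrix has
  positive (real) determinant — B1 l. 35 (Mathlib's `Matrix.PosDef.det_pos`).

Nothing here is a display; Mathlib + own file 102. Header declaration (README §8(d)): uses an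
L-value-free non-vanishing device: NO.
-/

open scoped TensorProduct ComplexConjugate ComplexOrder
open NumberField NumberField.IsCMField Module Matrix

namespace Summit.Ventures.HodgeRepro2.T5CMHermitianRealPlace

open T5CMRealBaseChange

variable (K : Type*) [Field K] [NumberField K] [IsCMField K]
variable {ι : Type*} [Fintype ι] [DecidableEq ι]

/-! ## 1. Complex embeddings intertwine `star = complexConj K` with `conj`; hermitian Gram
matrices stay hermitian -/

/-- Every complex embedding of a CM field intertwines `star` (= `complexConj K`) with `conj`
(Mathlib's `complexEmbedding_complexConj`). -/
theorem semiconj_star (φ : K →+* ℂ) : Function.Semiconj φ star star := fun x =>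
  complexEmbedding_complexConj K φ x

/-- `φ (star x) = conj (φ x)`. -/
theorem map_star (φ : K →+* ℂ) (x : K) : φ (star x) = conj (φ x) :=
  complexEmbedding_complexConj K φ x

omit [Fintype ι] [DecidableEq ι] in
/-- The complex Gram matrix `H.map φ` of a hermitian `H` over `K` is hermitian. -/
theorem isHermitian_map (φ : K →+* ℂ) {H : Matrix ι ι K} (hH : H.IsHermitian) :
    (H.map φ).IsHermitian :=
  hH.map φ (semiconj_star K φ)

omit [DecidableEq ι] in
/-- A ring hom commutes with the Gram form `star v ⬝ᵥ H *ᵥ w`. -/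
theorem map_gram (φ : K →+* ℂ) (H : Matrix ι ι K) (v w : ι → K) :
    φ (star v ⬝ᵥ H *ᵥ w) = star (φ ∘ v) ⬝ᵥ (H.map φ) *ᵥ (φ ∘ w) := by
  rw [RingHom.map_dotProduct]
  have h1 : φ ∘ star v = star (φ ∘ v) := funext fun i => map_star K φ (v i)
  have h2 : φ ∘ (H *ᵥ w) = H.map φ *ᵥ (φ ∘ w) := funext fun i => RingHom.map_mulVec φ H w i
  rw [h1, h2]

/-! ## 2. The base change of the hermitian space: `ℝ ⊗[K⁺] (ι → K) ≃ (ι → ℂ)` and its Gram form -/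

section RealPlace

variable [Algebra (maximalRealSubfield K) ℝ] [Algebra (maximalRealSubfield K) ℂ]
  [IsScalarTower (maximalRealSubfield K) ℝ ℂ]

/-- `ℝ ⊗[K⁺] (ι → K) ≃ₗ[ℝ] (ι → ℂ)`: Mathlib's `TensorProduct.piRight` followed by file 102's
`baseChangeEquiv K φ` in every coordinate. -/
noncomputable def piBaseChangeEquiv (φ : K →ₐ[maximalRealSubfield K] ℂ) :
    ℝ ⊗[maximalRealSubfield K] (ι → K) ≃ₗ[ℝ] (ι → ℂ) :=
  (TensorProduct.piRight (maximalRealSubfield K) ℝ ℝ (fun _ : ι => K)).trans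
    (LinearEquiv.piCongrRight fun _ => (baseChangeEquiv K φ).toLinearEquiv)

/-- `piBaseChangeEquiv K φ (r ⊗ v) = (r • φ (v i))_i`. -/
theorem piBaseChangeEquiv_tmul (φ : K →ₐ[maximalRealSubfield K] ℂ) (r : ℝ) (v : ι → K) :
    piBaseChangeEquiv K φ (r ⊗ₜ v) = fun i => r • φ (v i) := by
  ext i
  simp [piBaseChangeEquiv, TensorProduct.piRightHom_tmul]

/-- `piBaseChangeEquiv K φ (r ⊗ v) = (r : ℂ) • (φ ∘ v)`. -/
theorem piBaseChangeEquiv_tmul_eq_smul (φ : K →ₐ[maximalRealSubfield K] ℂ) (r : ℝ)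
    (v : ι → K) : piBaseChangeEquiv K φ (r ⊗ₜ v) = (r : ℂ) • (φ ∘ v) := by
  rw [piBaseChangeEquiv_tmul]
  ext i
  simp [Complex.real_smul]

/-- B1 l. 33, «V ⊗_{F⁺,τ} ℝ = ℂ³ with the form»: the complex Gram form `star x ⬝ᵥ (H.map φ) *ᵥ y`
of the base-changed vectors `r ⊗ v`, `s ⊗ w` is `(r s) • φ (star v ⬝ᵥ H *ᵥ w)`, the real scalars
passing through the (real) place. -/
theorem gram_piBaseChangeEquiv_tmul (φ : K →ₐ[maximalRealSubfield K] ℂ) (H : Matrix ι ι K)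
    (r s : ℝ) (v w : ι → K) :
    star (piBaseChangeEquiv K φ (r ⊗ₜ v)) ⬝ᵥ (H.map φ) *ᵥ piBaseChangeEquiv K φ (s ⊗ₜ w) =
      (r * s) • φ (star v ⬝ᵥ H *ᵥ w) := by
  have hg : φ (star v ⬝ᵥ H *ᵥ w) = star (φ ∘ v) ⬝ᵥ (H.map φ) *ᵥ (φ ∘ w) :=
    map_gram K (φ : K →+* ℂ) H v w
  rw [piBaseChangeEquiv_tmul_eq_smul, piBaseChangeEquiv_tmul_eq_smul, star_smul,
    smul_dotProduct, Matrix.mulVec_smul, dotProduct_smul, hg]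
  simp only [Complex.star_def, Complex.conj_ofReal, smul_eq_mul, Complex.real_smul,
    Complex.ofReal_mul]
  ring

/-! ## 3. The signature convention (B1 l. 41, Liu p. 107 l. 23): the other extension conjugates
the Gram matrix, which is its transpose — same characteristic polynomial, same determinant -/

omit [NumberField K] [IsCMField K] [Fintype ι] [DecidableEq ι] in
/-- Through the other extension `conj ∘ φ`, the Gram matrix is the entrywise conjugate. -/
theorem map_conjExt (φ : K →ₐ[maximalRealSubfield K] ℂ) (H : Matrix ι ι K) :
    H.map (conjExt φ) = (H.map φ).map conj := by
  ext i j
  rfl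

omit [Fintype ι] [DecidableEq ι] in
/-- For hermitian `H`, the entrywise conjugate of `H.map φ` is its transpose. -/
theorem map_conjExt_eq_transpose (φ : K →ₐ[maximalRealSubfield K] ℂ) {H : Matrix ι ι K}
    (hH : H.IsHermitian) : H.map (conjExt φ) = (H.map φ)ᵀ := by
  rw [map_conjExt]
  ext i j
  have h := congrFun (congrFun (isHermitian_map K (φ : K →+* ℂ) hH).eq j) i
  rw [Matrix.conjTranspose_apply] at h
  simpa [Matrix.map_apply, Matrix.transpose_apply] using h

/-- B1 l. 41 / Liu p. 107 l. 23: the two complex Gram matrices have the same characteristic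
polynomial — hence the same eigenvalues and the same signature (Mathlib's
`Matrix.charpoly_transpose`). -/
theorem charpoly_map_conjExt (φ : K →ₐ[maximalRealSubfield K] ℂ) {H : Matrix ι ι K}
    (hH : H.IsHermitian) : (H.map (conjExt φ)).charpoly = (H.map φ).charpoly := by
  rw [map_conjExt_eq_transpose K φ hH, Matrix.charpoly_transpose]

/-- … and the same determinant. -/
theorem det_map_conjExt (φ : K →ₐ[maximalRealSubfield K] ℂ) {H : Matrix ι ι K}
    (hH : H.IsHermitian) : (H.map (conjExt φ)).det = (H.map φ).det := by
  rw [map_conjExt_eq_transpose K φ hH, Matrix.det_transpose]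

/-- The determinant of the complex Gram matrix of a hermitian `H` is real
(`conj det = det`). -/
theorem det_map_real (φ : K →ₐ[maximalRealSubfield K] ℂ) {H : Matrix ι ι K}
    (hH : H.IsHermitian) : conj ((H.map φ).det) = (H.map φ).det := by
  have h := det_map_conjExt K φ hH
  rw [map_conjExt] at h
  rw [RingHom.map_det, RingHom.mapMatrix_apply]
  exact h

end RealPlace

/-! ## 4. B1 l. 35: a positive definite Gram matrix has positive determinant -/

omit [NumberField K] [IsCMField K] in
/-- B1 l. 35, «D_τ > 0»: a positive definite complex Gram matrix has positive determinant
(Mathlib's `Matrix.PosDef.det_pos`, in the `ComplexOrder`). -/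
theorem det_pos_of_posDef (φ : K →+* ℂ) {H : Matrix ι ι K} (hpos : (H.map φ).PosDef) :
    0 < (H.map φ).det :=
  hpos.det_pos

omit [NumberField K] [IsCMField K] in
/-- The same, read on the real and imaginary parts: `re det > 0` and `im det = 0`. -/
theorem det_re_pos_of_posDef (φ : K →+* ℂ) {H : Matrix ι ι K} (hpos : (H.map φ).PosDef) :
    0 < ((H.map φ).det).re ∧ ((H.map φ).det).im = 0 := by
  have h := det_pos_of_posDef K φ hpos
  rw [Complex.lt_def] at h
  exact ⟨by simpa using h.1, by simpa using h.2.symm⟩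

end Summit.Ventures.HodgeRepro2.T5CMHermitianRealPlace
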